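import Summits.QuantumFields.YangMills.Theorems.UnitScaleTiltProp7Growth142T3
import HarnessLib

/-!
# Route `UnitScaleTilt`, crux K1 child «MinimiserStabilityRegPr» (stmt-QuantumFields-19200), skeleton v10, stub `stub_existenceMinimalOrbit`, route (α) — (S3)(ii) THE MINIMALITY
# HALF OF C-min IN CHART LETTERS ([Balaban1985Variational] p. 299, (141)–(142): at the critical chart point «B = 0, ⟨A′, J⟩ = 0, 𝔉(A′) = A(U_k) + ½⟨A′, Δ₁A′⟩ + V(A′),
# the second differential is positive definite, hence A′ = 0 is a minimum»): the local-minimum calculus PROVED abstractly, the four print rows DISPLAYED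

Cell `ym3-torus`, width seat `ym-ust-19200-w4` (gen 0; OWNER 2026-08-28 02:05:20Z ∕ 02:07:44Z: «ADD the chart-letter twin `growth142_T3_chart` … (a) (116) by name, (b) TAYLOR-3,
(c) δ𝔄_X = 0 on the slice, (d) δ²𝔄 ≥ (116) − Cε₄ ⇒ local min ⇒ transport»).  Companion of `Prop7Growth142T3.growth142_T3` (the (γ)-currency junction, p596198).
THEOREMS ONLY (0 `def`, 0 `sorry`).  YM₃ on T³ is a ladder rung (R3), not the Clay problem; nothing here claims the stub, the crux, d = 4 or the mass gap.

THE SHAPE.  Print's argument lives in the RE-CENTRED, (47)-straightened chart `Φ_W` at the critical point `W = e^{iX}U₀` («we apply the whole procedure with the configuration U_k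
instead of U₀», p. 299): on its direction space (43)_W the constraint (20) is LINEAR ((48)), the first differential of `𝔉_W = A ∘ Φ_W` vanishes ((141), Prop. 6's equation), the
second is the form `½⟨·, Δ₁·⟩` bounded below by (116) (the cell's PROVED linearised-slice coercivity `Prop7CovariantCoercivity.wilsonAction4_sub_background_ge_of_regPr_T3` is this
form at `Y = dΦ_W δ`), and the third-order remainder is `O(ε₄)·‖δ‖²` on the `ε₄`-ball.  LOCATED (posted 02:1xZ): the object `Φ_W` with the dictionary `dΦ_W δ ↦ Y` on `W`'s
linearised slice is NOT in the tree at T³ (w2's row (i), at background `W`), so (116) cannot be invoked by name on C-min's competitor set {(20), (21), `nMax19 < ε₄`} — the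
competitors `e^{iX′}U₀` are neither Landau w.r.t. `W` nor on `W`'s linearised averaging slice.  Hence this file PROVES the calculus (§1) and DISPLAYS the four T³ rows (§2):
* CHART_W  — every admissible `X′` is charted: `A(e^{iX′}U₀) = f δ` for some `δ` in the slice `S` with `‖δ‖ ≤ ρ`, and `f 0 = A(e^{iX}U₀)` ((47)–(48) at `W` + [B8] Thm 2's covering);
* EL_W     — the first differential `ℓ` of `f` vanishes on `S` ((141); Prop. 6's equation (111) transported to `W`, ★w2-19200 g2's `prop6_T3` output);
* HESS_W   — the quadratic part `q` of `f` is `κ`-coercive on `S` ((116) = [Balaban1985BackgroundPropagators] Thm 3.11∕3.12 at `W`; = p1's theorem once `dΦ_W` is identified);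
* TAYLOR3_W — `f δ − f 0 − ℓ δ − q δ ≥ −C_T·ρ·‖δ‖²` on `S ∩ ball(ρ)` (third-order remainder of the Wilson action through the chart; W-sized calculus once `Φ_W` has a body).

WHAT IS PROVED (ns `…Theorems.Prop7Growth142T3Chart`).  §1 `le_of_taylor3_coercive_slice` (abstract: EL ∧ HESS ∧ TAYLOR-3 ∧ `C_T ρ ≤ κ` ⇒ `f 0 ≤ f δ` on the slice-ball).
§2 ★ `growth142_T3_chart : CHART_W → EL_W → HESS_W → TAYLOR3_W → (C_T ρ ≤ κ) → <C-min's minimality clause VERBATIM>` (same conclusion as `growth142_T3`).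

HONEST SCOPE.  §1 is elementary real algebra; §2 is bookkeeping; the four rows are DISPLAYED hypotheses carrying all of [Balaban1985Variational] Sect. E's content at the
critical point; nothing of print is asserted; `--supports stmt-QuantumFields-19200`, count-neutral.

References: T. Bałaban, CMP 102 (1985) 277–309 [Balaban1985Variational] ((43) p.285, (47)–(48) p.286, (111)–(112) p.294, (116) p.295, (141)–(142) p.299); CMP 99 (1985) 389–434
[Balaban1985BackgroundPropagators] (Thm 3.11, Thm 3.12).
-/

set_option autoImplicit false

noncomputable section

open scoped Matrix.Norms.L2Operator

namespace Summit.QuantumFields.YangMills.Theorems.Prop7Growth142T3Chart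

open Literature.MathematicalPhysics.QuantumFieldTheory.Balaban1983to89
open Literature.MathematicalPhysics.QuantumFieldTheory.Balaban1983to89.T3ContinuumYM3Torus
open Literature.MathematicalPhysics.QuantumFieldTheory.Balaban1983to89.T3UnitLawDensityEML (ℰp)
open Literature.MathematicalPhysics.QuantumFieldTheory.Balaban1983to89.T3Thm1Carrier
open Literature.MathematicalPhysics.QuantumFieldTheory.Balaban1983to89.T3SectALandauChart (emb15)
open Summit.QuantumFields.YangMills.Theorems.Prop7TPrint (nMax19 expHermField)
open Summit.QuantumFields.YangMills.Theorems.Prop7SPrint (AvgCondPrint IsLandauPrint)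

/-! ## §1 The local-minimum calculus of (141)–(142), abstractly -/

/-- **(141)–(142) ABSTRACTLY**: on a slice `S` of a real normed space, if `f δ − f 0 − ℓ δ − q δ ≥ −C_T·ρ·‖δ‖²` for `δ ∈ S`, `‖δ‖ ≤ ρ` (third-order Taylor), the linear part
vanishes on `S` (criticality, (141)) and the quadratic part is `κ`-coercive on `S` ((116)∕(142)), then `f 0 ≤ f δ` on the slice-ball as soon as `C_T·ρ ≤ κ` (print: «positive
definite, hence A′ = 0 is a minimum», with the radius ε₄ small). [cite: Balaban1985Variational, (141)-(142) p.299, (116) p.295] -/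
theorem le_of_taylor3_coercive_slice {E : Type*} [NormedAddCommGroup E] (f : E → ℝ) (ℓ q : E → ℝ) (S : Set E) {ρ C κ : ℝ}
    (hT : ∀ δ ∈ S, ‖δ‖ ≤ ρ → -(C * ρ * ‖δ‖ ^ 2) ≤ f δ - f 0 - ℓ δ - q δ)
    (hEL : ∀ δ ∈ S, ℓ δ = 0) (hq : ∀ δ ∈ S, κ * ‖δ‖ ^ 2 ≤ q δ) (hκ : C * ρ ≤ κ) :
    ∀ δ ∈ S, ‖δ‖ ≤ ρ → f 0 ≤ f δ := by
  intro δ hδ hρ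
  have h1 := hT δ hδ hρ
  have h2 := hEL δ hδ
  have h3 := hq δ hδ
  have h4 : 0 ≤ (κ - C * ρ) * ‖δ‖ ^ 2 := mul_nonneg (by linarith) (sq_nonneg _)
  nlinarith

/-! ## §2 ★ C-min's minimality clause from the four displayed chart rows at the critical point -/

/-- ★ **THE MINIMALITY HALF OF C-min IN CHART LETTERS** — conclusion VERBATIM the last clause of C-min (`Prop7ExistRouteAlphaMin.existenceMinimalOrbit_of_Cmin_cov`'s `hC`), from
CHART_W (every admissible competitor `X′` is `f δ`, `δ ∈ S`, `‖δ‖ ≤ ρ`; `f 0 = A(e^{iX}U₀)`), EL_W (`ℓ|_S = 0`), HESS_W (`q ≥ κ‖·‖²` on `S` — the slot p1's (116) fills once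
`dΦ_W` is identified), TAYLOR3_W (third-order remainder `≤ C_T ρ‖δ‖²`) and the smallness `C_T ρ ≤ κ`. [cite: Balaban1985Variational, (141)-(142) p.299, (47)-(48) p.286, Prop. 6 p.295] -/
theorem growth142_T3_chart (F : T3Family) {n K : ℕ} (hnK : n < K) {ε₄ : ℝ}
    (V : GaugeField (F.P n) 0 (Matrix.specialUnitaryGroup (Fin 2) ℂ)) (U₀ : GaugeField (F.P K) 0 (Matrix.specialUnitaryGroup (Fin 2) ℂ))
    (X : PBond (F.P K) 0 → Matrix (Fin 2) (Fin 2) ℂ)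
    {E : Type*} [NormedAddCommGroup E] (f : E → ℝ) (ℓ q : E → ℝ) (S : Set E) {ρ C κ : ℝ}
    (hCHART : ∀ X' : PBond (F.P K) 0 → Matrix (Fin 2) (Fin 2) ℂ, nMax19 F n K U₀ X' < ε₄ →
      (∀ b : PBond (F.P K) 0, (X' b).IsHermitian ∧ Matrix.trace (X' b) = 0) →
        AvgCondPrint F n K hnK.le V U₀ X' → IsLandauPrint F n K U₀ X' →
          ∃ δ ∈ S, ‖δ‖ ≤ ρ ∧ wilsonAction4 (emb15 U₀ (expHermField X')) = f δ)
    (hcentre : f 0 = wilsonAction4 (emb15 U₀ (expHermField X)))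
    (hT : ∀ δ ∈ S, ‖δ‖ ≤ ρ → -(C * ρ * ‖δ‖ ^ 2) ≤ f δ - f 0 - ℓ δ - q δ)
    (hEL : ∀ δ ∈ S, ℓ δ = 0) (hq : ∀ δ ∈ S, κ * ‖δ‖ ^ 2 ≤ q δ) (hκ : C * ρ ≤ κ) :
    ∀ X' : PBond (F.P K) 0 → Matrix (Fin 2) (Fin 2) ℂ, nMax19 F n K U₀ X' < ε₄ →
      (∀ b : PBond (F.P K) 0, (X' b).IsHermitian ∧ Matrix.trace (X' b) = 0) →
        AvgCondPrint F n K hnK.le V U₀ X' → IsLandauPrint F n K U₀ X' →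
          wilsonAction4 (emb15 U₀ (expHermField X)) ≤ wilsonAction4 (emb15 U₀ (expHermField X')) := by
  intro X' hX'ε hX'h h20' h21'
  obtain ⟨δ, hδS, hδρ, hA⟩ := hCHART X' hX'ε hX'h h20' h21'
  rw [hA, ← hcentre]
  exact le_of_taylor3_coercive_slice f ℓ q S hT hEL hq hκ δ hδS hδρ

/-! ## §3 The same with an APPROXIMATE Euler–Lagrange row: the Lagrange-multiplier curvature term of the constrained problem

At the critical point of the CONSTRAINED problem the first differential of `f = A ∘ Φ_W` vanishes only on the tangent directions of the slice; along the fibre (a graph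
over that tangent space) the first-order functional pairs with the second-order graph term, `ℓ δ = ⟨λ, D₂(δ, δ)⟩ = O(a)·‖δ‖²` with `a` the background plaquette radius
(seat LOCATED 2026-08-28 02:28Z, (z2)).  The honest shape of OWNER's row (d) «δ²𝔄 ≥ (116) − C·ε₄» is therefore: `|ℓ δ| ≤ λ‖δ‖²` on the slice and `C_T ρ + λ ≤ κ`. -/

/-- **(141)–(142) WITH AN APPROXIMATE EULER–LAGRANGE ROW**: if `f δ − f 0 − ℓ δ − q δ ≥ −C·ρ·‖δ‖²` (Taylor-3), `|ℓ δ| ≤ λ‖δ‖²` (criticality up to the multiplier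
curvature term) and `q δ ≥ κ‖δ‖²` on the slice, then `f 0 ≤ f δ` on the slice-ball as soon as `C·ρ + λ ≤ κ`. [cite: Balaban1985Variational, (141)-(142) p.299, (116) p.295] -/
theorem le_of_taylor3_coercive_slice_of_approxEL {E : Type*} [NormedAddCommGroup E] (f : E → ℝ) (ℓ q : E → ℝ) (S : Set E) {ρ C κ lam : ℝ}
    (hT : ∀ δ ∈ S, ‖δ‖ ≤ ρ → -(C * ρ * ‖δ‖ ^ 2) ≤ f δ - f 0 - ℓ δ - q δ)
    (hEL : ∀ δ ∈ S, |ℓ δ| ≤ lam * ‖δ‖ ^ 2) (hq : ∀ δ ∈ S, κ * ‖δ‖ ^ 2 ≤ q δ) (hκ : C * ρ + lam ≤ κ) :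
    ∀ δ ∈ S, ‖δ‖ ≤ ρ → f 0 ≤ f δ := by
  intro δ hδ hρ
  have h1 := hT δ hδ hρ
  have h2 := (abs_le.mp (hEL δ hδ)).1
  have h3 := hq δ hδ
  have h4 : 0 ≤ (κ - C * ρ - lam) * ‖δ‖ ^ 2 := mul_nonneg (by linarith) (sq_nonneg _)
  nlinarith

/-- ★ **THE MINIMALITY HALF OF C-min IN CHART LETTERS, APPROXIMATE-EL FORM** — conclusion VERBATIM the last clause of C-min, from CHART_W, TAYLOR3_W, the approximate
Euler–Lagrange row `|ℓ δ| ≤ λ‖δ‖²` (Prop 6's equation on the tangent directions + the multiplier curvature term along the fibre), HESS_W and `C_T ρ + λ ≤ κ`.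
[cite: Balaban1985Variational, (141)-(142) p.299, (47)-(48) p.286, Prop. 6 p.295] -/
theorem growth142_T3_chart_approxEL (F : T3Family) {n K : ℕ} (hnK : n < K) {ε₄ : ℝ}
    (V : GaugeField (F.P n) 0 (Matrix.specialUnitaryGroup (Fin 2) ℂ)) (U₀ : GaugeField (F.P K) 0 (Matrix.specialUnitaryGroup (Fin 2) ℂ))
    (X : PBond (F.P K) 0 → Matrix (Fin 2) (Fin 2) ℂ)
    {E : Type*} [NormedAddCommGroup E] (f : E → ℝ) (ℓ q : E → ℝ) (S : Set E) {ρ C κ lam : ℝ}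
    (hCHART : ∀ X' : PBond (F.P K) 0 → Matrix (Fin 2) (Fin 2) ℂ, nMax19 F n K U₀ X' < ε₄ →
      (∀ b : PBond (F.P K) 0, (X' b).IsHermitian ∧ Matrix.trace (X' b) = 0) →
        AvgCondPrint F n K hnK.le V U₀ X' → IsLandauPrint F n K U₀ X' →
          ∃ δ ∈ S, ‖δ‖ ≤ ρ ∧ wilsonAction4 (emb15 U₀ (expHermField X')) = f δ)
    (hcentre : f 0 = wilsonAction4 (emb15 U₀ (expHermField X)))
    (hT : ∀ δ ∈ S, ‖δ‖ ≤ ρ → -(C * ρ * ‖δ‖ ^ 2) ≤ f δ - f 0 - ℓ δ - q δ)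
    (hEL : ∀ δ ∈ S, |ℓ δ| ≤ lam * ‖δ‖ ^ 2) (hq : ∀ δ ∈ S, κ * ‖δ‖ ^ 2 ≤ q δ) (hκ : C * ρ + lam ≤ κ) :
    ∀ X' : PBond (F.P K) 0 → Matrix (Fin 2) (Fin 2) ℂ, nMax19 F n K U₀ X' < ε₄ →
      (∀ b : PBond (F.P K) 0, (X' b).IsHermitian ∧ Matrix.trace (X' b) = 0) →
        AvgCondPrint F n K hnK.le V U₀ X' → IsLandauPrint F n K U₀ X' →
          wilsonAction4 (emb15 U₀ (expHermField X)) ≤ wilsonAction4 (emb15 U₀ (expHermField X')) := by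
  intro X' hX'ε hX'h h20' h21'
  obtain ⟨δ, hδS, hδρ, hA⟩ := hCHART X' hX'ε hX'h h20' h21'
  rw [hA, ← hcentre]
  exact le_of_taylor3_coercive_slice_of_approxEL f ℓ q S hT hEL hq hκ δ hδS hδρ

end Summit.QuantumFields.YangMills.Theorems.Prop7Growth142T3Chart

end
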